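import Summits.BirchSwinnertonDyer.BirchSwinnertonDyer.Theorems.ErratumRoadFiveNonSurjCornerKolyJRedefinitionSharp
import Summits.BirchSwinnertonDyer.BirchSwinnertonDyer.Theorems.ClassRecordThreeEulerHalvesAtThreeJetchevMaxOfSwap
import HarnessLib

/-!
# Route `ClassRecordThree` ∕ `KolyvaginRoadThree` (rung K2@3), crux `EulerHalvesAtThree` (item stmt-BirchSwinnertonDyer-19109),
# registered stub `stub_jetchevMaxHLAtThree`: the display SHARPENED — «stub ⟸ {hswap, hlev}», no finiteness ∕ McCallum-5.2 ∕
# Gross–Zagier input (cell `bsd-stepL`, seat `bsd-stepL-corner-p1` g8, courtesy for tam3-p1; `--supports stmt-BirchSwinnertonDyer-19109`)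

WHAT. `jetchevMaxHLAtThree_of_swap_of_perLevel` (p509708) read the stub ⟸ {hfin, hswap, hlev}. By the case split of
`Koly.pDiv_of_swap_of_perLevel` (`…KolyJRedefinitionSharp`: if no admissible `(n, d)` has `ord₃ P_n < M(n)` the stub holds on the
nose) the finiteness input is unnecessary: **`jetchevMaxHLAtThree_of_swap_of_perLevel'`** = the stub VERBATIM ⟸ {hswap (swap
supply at the frame, abstract kernel p505956 ∕ instantiated p510753–p512423), hlev (walk supply, tam3's p504178)}. One theorem;
CONDITIONAL; the stub is NOT discharged; no item closes; T7.
References: [McCallumLMS1991] §5 Prop. 5.2; [BurungaleEtAl2026] Prop. 2.2.1; [Jetchev2008] Thm. 1.4.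
-/

set_option autoImplicit false

noncomputable section

open scoped Classical NumberField

namespace Summit.BirchSwinnertonDyer.Rank1Residual.X11b.Three.Koly

open WeierstrassCurve Literature.NumberTheory.EllipticCurves
  Literature.NumberTheory.EllipticCurves.ModularForms
  Literature.NumberTheory.EllipticCurves.Rank1Residual
  Summit.BirchSwinnertonDyer.Rank1Residual Summit.BirchSwinnertonDyer.Rank1Residual.X11b
  IsDedekindDomain NumberField

/-- **`stub_jetchevMaxHLAtThree` (19109) ⟸ {hswap, hlev}** — tam3-p1's J₃ frames; no finiteness, McCallum-5.2 or Gross–Zagier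
input. CONDITIONAL; nothing booked. [cite: Jetchev2008, Thm. 1.4 (p. 812)] [cite: McCallumLMS1991, §5 Prop. 5.2 (p. 304)]
[cite: BurungaleEtAl2026, Prop. 2.2.1 (§2.2)] -/
theorem jetchevMaxHLAtThree_of_swap_of_perLevel'
    (hswap : ∀ (W : WeierstrassCurve ℚ) [W.IsElliptic] [W.IsGloballyMinimal] [NeZero (W.conductorNorm ℤ)]
      (K : Type) [Field K] [NumberField K]
      (Dt : ModularParametrizationData W (W.conductorNorm ℤ)) (β : ℤ) (ι : K →+* ℂ),
      W.analyticRank = 1 → W.HasMultiplicativeReductionAtPrime 3 → Surj W 3 →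
      IsImaginaryQuadratic K → SatisfiesHeegnerHypothesis (W.conductorNorm ℤ) K →
      Odd (NumberField.discr K) → (W.quadraticTwist (NumberField.discr K : ℚ)).entireLFunction 1 ≠ 0 →
      (4 * (W.conductorNorm ℤ : ℤ)) ∣ β ^ 2 - NumberField.discr K → ¬ (3 : ℤ) ∣ Dt.c →
      ∀ (M e : ℕ) (n : ℕ) (d : KolyvaginHeegnerData Dt β ι n), Squarefree n →
        (∀ ℓ ∈ n.primeFactors, Zhang2014.IsKolyvaginPrime (W.conductorNorm ℤ) W K 3 ℓ ∧
          M + 1 ≤ Zhang2014.kolyvaginIndex W 3 ℓ) →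
        (∀ (n' : ℕ) (d' : KolyvaginHeegnerData Dt β ι n'), Squarefree n' →
          (∀ ℓ ∈ n'.primeFactors, Zhang2014.IsKolyvaginPrime (W.conductorNorm ℤ) W K 3 ℓ ∧
            M + 1 ≤ Zhang2014.kolyvaginIndex W 3 ℓ) → PDiv d' 3 M) →
        ¬ PDiv d 3 (M + 1) →
        ∃ (n' : ℕ) (d' : KolyvaginHeegnerData Dt β ι n'), Squarefree n' ∧
          (∀ ℓ ∈ n'.primeFactors, Zhang2014.IsKolyvaginPrime (W.conductorNorm ℤ) W K 3 ℓ ∧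
            e ≤ Zhang2014.kolyvaginIndex W 3 ℓ) ∧ ¬ PDiv d' 3 (M + 1))
    (hlev : ∀ (W : WeierstrassCurve ℚ) [W.IsElliptic] [W.IsGloballyMinimal] [NeZero (W.conductorNorm ℤ)]
      (K : Type) [Field K] [NumberField K]
      (Dt : ModularParametrizationData W (W.conductorNorm ℤ)) (β : ℤ) (ι : K →+* ℂ),
      W.analyticRank = 1 → W.HasMultiplicativeReductionAtPrime 3 → Surj W 3 →
      IsImaginaryQuadratic K → SatisfiesHeegnerHypothesis (W.conductorNorm ℤ) K →
      Odd (NumberField.discr K) → (W.quadraticTwist (NumberField.discr K : ℚ)).entireLFunction 1 ≠ 0 →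
      (4 * (W.conductorNorm ℤ : ℤ)) ∣ β ^ 2 - NumberField.discr K → ¬ (3 : ℤ) ∣ Dt.c →
      ∀ (v : HeightOneSpectrum (𝓞 ℚ)) (k n : ℕ) (d : KolyvaginHeegnerData Dt β ι n), Squarefree n →
        (∀ ℓ ∈ n.primeFactors, Zhang2014.IsKolyvaginPrime (W.conductorNorm ℤ) W K 3 ℓ) →
        (if divOrd d 3 < Zhang2014.levelIndex W 3 n then divOrd d 3 else (⊤ : ℕ∞)) < (k : ℕ∞) →
        padicValNat 3 (W.tamagawaNumberAt v) ≤ k →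
        (k : ℕ∞) + (if divOrd d 3 < Zhang2014.levelIndex W 3 n then divOrd d 3 else ⊤) ≤
          Zhang2014.levelIndex W 3 n →
        (padicValNat 3 (W.tamagawaNumberAt v) : ℕ∞) ≤
          (if divOrd d 3 < Zhang2014.levelIndex W 3 n then divOrd d 3 else ⊤)) :
    ∀ (W : WeierstrassCurve ℚ) [W.IsElliptic] [W.IsGloballyMinimal] [NeZero (W.conductorNorm ℤ)]
      (K : Type) [Field K] [NumberField K]
      (Dt : ModularParametrizationData W (W.conductorNorm ℤ)) (β : ℤ) (ι : K →+* ℂ),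
      W.analyticRank = 1 → W.HasMultiplicativeReductionAtPrime 3 → Surj W 3 →
      IsImaginaryQuadratic K → SatisfiesHeegnerHypothesis (W.conductorNorm ℤ) K →
      Odd (NumberField.discr K) → (W.quadraticTwist (NumberField.discr K : ℚ)).entireLFunction 1 ≠ 0 →
      (4 * (W.conductorNorm ℤ : ℤ)) ∣ β ^ 2 - NumberField.discr K → ¬ (3 : ℤ) ∣ Dt.c →
      ∀ (v : HeightOneSpectrum (𝓞 ℚ)) (s : ℕ), s ≤ padicValNat 3 (W.tamagawaNumberAt v) →
        ∀ (n : ℕ) (d : KolyvaginHeegnerData Dt β ι n), Squarefree n →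
          (∀ ℓ ∈ n.primeFactors, Zhang2014.IsKolyvaginPrime (W.conductorNorm ℤ) W K 3 ℓ ∧
            s ≤ Zhang2014.kolyvaginIndex W 3 ℓ) → PDiv d 3 s := by
  intro W _ _ _ K _ _ Dt β ι hr hmult hρ hK' hHN hodd hLt hβ hc v s hs n d hn hℓ
  exact pDiv_of_swap_of_perLevel 3 (padicValNat 3 (W.tamagawaNumberAt v))
    (hswap W K Dt β ι hr hmult hρ hK' hHN hodd hLt hβ hc)
    (fun k n d hn' hℓ' h1 h2 h3 => hlev W K Dt β ι hr hmult hρ hK' hHN hodd hLt hβ hc v k n d hn' hℓ' h1 h2 h3)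
    s hs n d hn hℓ

end Summit.BirchSwinnertonDyer.Rank1Residual.X11b.Three.Koly

end
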